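import Summits.ValiantsHypothesis.ValiantsHypothesis.Theorems.LacunarySymmetroidMatrixDescartesDoorA26WallBubblingWeylGenericSingleCluster
import Summits.ValiantsHypothesis.ValiantsHypothesis.Theorems.LacunarySymmetroidMatrixDescartesDoorA26WallBubblingWeyl321Limit

/-!
# Wall bubbling for `DoorA26` — THE STRATUM [3,2,1]: no bounded-ratio twenties near a value-generic [3,2,1] point (`x`-currency corollary)

HONEST FRAMING.  Obligation (W) `Stmt.stub_weylFaces` of `Cruxes/DoorA26/Lines/wall_bubbling.lean` (crux `DoorA26`, stmt-ValiantsHypothesis-19979;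
OPEN, typed, never asserted); statement file `Cruxes/DoorA26/Lines/wall_bubbling_ConfluentDoor.lean` rev 13, hypothesis `TripleStratum26` of the
(W) ledger «(W) ⟸ ConfluentDoor26 ∧ NoTightChain26NC ∧ (M) ∧ TripleStratum26» — the stratum [3,2,1] in the positions of chain `h321` of #91: a pair
`δ₀ = δ₁`, a single `δ₂`, a triple `δ₃ = δ₄ = δ₅`, the three values (at `![0,2,3]`) 2-Sidon.  W1 seat val-sym-door-p2 g15 (#109); `x`-currency companion of #108.  Def-free:

* **`no_twenty_window_weyl321`** — THE DOOR-FREE SINGLE-CLUSTER THEOREM at [3,2,1]: twenty zeros in a fixed window are impossible — #108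
  `weyl321Limit` + W2 `multiplicity_transfer_iteratedDeriv` + #107 `weyl321_zerosWithMultiplicity_le` (slots `20` either way; one dead slot suffices and
  the single's pure class or the triple's sixth slot provides it — correcting memo TRIPLE-STRATUM-g15 §4's pessimism for this pattern);
* `no_boundedRatio_twenties_weyl321` — its `x`-currency corollary: no bounded-ratio twenties (`x_k ≤ R·x_0` at every stage) near a value-generic
  point of the stratum [3,2,1].

The multi-cluster case (rungs in slot currency; what a «sixth-slot cluster» costs elsewhere) and the patterns [3,3]/[4,2] (no single letter)
of `TripleStratum26` are NOT treated here.  Registers unchanged; `TripleStratum26`, (W), (M), `ConfluentDoor26`, `NoTightChain26NC`, `DoorA26`,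
`MatrixDescartes` (stmt-ValiantsHypothesis-18050) OPEN; nothing on VP ≠ VNP.  `--supports stmt-ValiantsHypothesis-19979 --as helper`.  [this work].
-/

-- `Summit.ValiantsHypothesis.ValiantsHypothesis.…` repeats a component by the D-0017 layout
-- (single-conjunct summit), which the `dupNamespace` linter flags; the name is mandated.
set_option linter.dupNamespace false

namespace Summit.ValiantsHypothesis.ValiantsHypothesis.Theorems.LacunarySymmetroidMatrixDescartes.WallBubbling

open Finset Filter Topology
open scoped BigOperators

/-- **NO TWENTY IN A WINDOW AT A VALUE-GENERIC POINT OF THE STRATUM [3,2,1] — NO DOOR.**  Positions of chain `h321` of #91: pair at `0,1`,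
single at `2`, triple at `3,4,5`; the three values `δ0 0, δ0 2, δ0 3` are 2-Sidon. [this work] -/
theorem no_twenty_window_weyl321
    (δs : ℕ → Fin 6 → ℝ) (δ0 : Fin 6 → ℝ) (hδ : ∀ l, Tendsto (fun ν => δs ν l) atTop (𝓝 (δ0 l)))
    (h10 : δ0 1 = δ0 0) (h43 : δ0 4 = δ0 3) (h53 : δ0 5 = δ0 3)
    (hvg : ∀ a b c d : Fin 3, δ0 ((![0, 2, 3] : Fin 3 → Fin 6) a) + δ0 ((![0, 2, 3] : Fin 3 → Fin 6) b)
        = δ0 ((![0, 2, 3] : Fin 3 → Fin 6) c) + δ0 ((![0, 2, 3] : Fin 3 → Fin 6) d) → (a = c ∧ b = d) ∨ (a = d ∧ b = c))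
    (U : ℕ → Fin 6 → Matrix (Fin 2) (Fin 2) ℝ) (hU : ∀ ν l, (U ν l).IsSymm)
    (hne : ∀ ν, ∃ t, (∑ l, Real.exp (δs ν l * t) • U ν l).det ≠ 0)
    (A B : ℝ) (hz : ∀ ν, ∃ z : Fin 20 → ℝ, StrictMono z ∧ ∀ i, z i ∈ Set.Icc A B ∧ (∑ l, Real.exp (δs ν l * z i) • U ν l).det = 0) :
    False := by
  obtain ⟨φ, _, a, c, hsymm, hcne, hdich, hconv⟩ := weyl321Limit δs δ0 hδ h10 h43 h53 U hU hne
  obtain ⟨Z, m, hZ, h20⟩ := multiplicity_transfer_iteratedDeriv A B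
    (fun k t => a k * (∑ l, Real.exp (δs (φ k) l * t) • U (φ k) l).det)
    (fun s => ∑ k : Fin 3 × Fin 3,
      (∑ m ∈ Finset.range ((fun k : Fin 3 × Fin 3 => (![![3, 2, 6], ![2, 1, 3], ![6, 3, 6]] : Fin 3 → Fin 3 → ℕ) k.1 k.2) k),
        c k m * s ^ m / (m.factorial : ℝ)) * Real.exp ((δ0 ((![0, 2, 3] : Fin 3 → Fin 6) k.1) + δ0 ((![0, 2, 3] : Fin 3 → Fin 6) k.2)) * s))
    (fun k n => contDiff_const.mul (contDiff_pencilDet _ _ n))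
    (fun j _ ψ hψ t t₀ _ ht => hconv j ψ hψ t t₀ ht)
    (fun k => by
      obtain ⟨z, hz1, hz2⟩ := hz (φ k)
      exact ⟨z, hz1, fun i => ⟨(hz2 i).1, by rw [(hz2 i).2, mul_zero]⟩⟩)
  have h19 := weyl321_zerosWithMultiplicity_le (fun b : Fin 3 => δ0 ((![0, 2, 3] : Fin 3 → Fin 6) b)) hvg c hsymm hcne hdich Z m
    (fun z hz' => ⟨Set.mem_univ _, (hZ z hz').2⟩)
  have h19' : ∑ z ∈ Z, m z ≤ 19 := h19
  omega

/-- **NO BOUNDED-RATIO TWENTIES NEAR A VALUE-GENERIC [3,2,1] POINT — NO DOOR** (`x`-currency: twenty positive roots `x_k` of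
`det Σ_l x^{δ_l} S_l` with `x_k ≤ R·x_0` at every stage). [this work] -/
theorem no_boundedRatio_twenties_weyl321
    (δ0 : Fin 6 → ℝ) (h10 : δ0 1 = δ0 0) (h43 : δ0 4 = δ0 3) (h53 : δ0 5 = δ0 3)
    (hvg : ∀ a b c d : Fin 3, δ0 ((![0, 2, 3] : Fin 3 → Fin 6) a) + δ0 ((![0, 2, 3] : Fin 3 → Fin 6) b)
        = δ0 ((![0, 2, 3] : Fin 3 → Fin 6) c) + δ0 ((![0, 2, 3] : Fin 3 → Fin 6) d) → (a = c ∧ b = d) ∨ (a = d ∧ b = c))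
    (δs : ℕ → Fin 6 → ℝ) (hδ : ∀ l, Tendsto (fun ν => δs ν l) atTop (𝓝 (δ0 l)))
    (S : ℕ → Fin 6 → Matrix (Fin 2) (Fin 2) ℝ) (hS : ∀ ν l, (S ν l).IsSymm)
    (hne : ∀ ν, ∃ y : ℝ, 0 < y ∧ (∑ l, (y ^ (δs ν l)) • S ν l).det ≠ 0)
    (R : ℝ) (x : ℕ → Fin 20 → ℝ) (hx : ∀ ν, StrictMono (x ν)) (hxpos : ∀ ν k, 0 < x ν k)
    (hxR : ∀ ν k, x ν k ≤ R * x ν 0) (hroot : ∀ ν k, (∑ l, (x ν k ^ (δs ν l)) • S ν l).det = 0) : False := by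
  have hR : 0 < R := by
    have h1 := hxR 0 0
    have h2 := hxpos 0 0
    nlinarith
  refine no_twenty_window_weyl321 δs δ0 hδ h10 h43 h53 hvg
    (fun ν l => (x ν 0 ^ (δs ν l)) • S ν l) (fun ν l => (hS ν l).smul _) ?_ 0 (Real.log R) ?_
  · intro ν
    obtain ⟨y, hy, hdet⟩ := hne ν
    refine ⟨Real.log y - Real.log (x ν 0), ?_⟩
    rw [← pencil_log_recenter (δs ν) (S ν) (hxpos ν 0) hy]
    exact hdet
  · intro ν
    refine ⟨fun k => Real.log (x ν k) - Real.log (x ν 0), fun k k' hkk' => ?_, fun k => ⟨⟨?_, ?_⟩, ?_⟩⟩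
    · exact sub_lt_sub_right (Real.log_lt_log (hxpos ν k) (hx ν hkk')) _
    · exact sub_nonneg.mpr (Real.log_le_log (hxpos ν 0) ((hx ν).monotone (Fin.zero_le k)))
    · rw [sub_le_iff_le_add, ← Real.log_mul hR.ne' (hxpos ν 0).ne']
      exact Real.log_le_log (hxpos ν k) (hxR ν k)
    · rw [← pencil_log_recenter (δs ν) (S ν) (hxpos ν 0) (hxpos ν k)]
      exact hroot ν k

end Summit.ValiantsHypothesis.ValiantsHypothesis.Theorems.LacunarySymmetroidMatrixDescartes.WallBubbling
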